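import Literature.MathematicalPhysics.KineticTheory.LangevinChainResolvent
import Mathlib.MeasureTheory.Integral.Bochner.SumMeasure
import Mathlib.Analysis.SpecificLimits.Basic

/-!
# Jump perturbation of a measurable Markov semigroup, V: the resolvent identity of the Neumann series
(brick for crux stmt-AtomisticToContinuum-11976 `VanishingNoiseTransfer.VanishingNoiseBound`, line
`fekete-usc-one-length`, stub S3 `stub_noisyPositiveConductance`; worker file, wave 2)

Step V of the construction of the flip semigroup of `L + εS` as a jump perturbation of the flip-free
transition semigroup (overview in `…JumpPerturbationCore.lean`). This step is independent of the
Dyson–Phillips family: it is the GENERATOR side. Data: a Markov kernel `K` from `ℝ × X` to `X` (the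
time-extended unperturbed transition kernel), a Markov jump kernel `Q`, a rate `r > 0`, a Laplace
variable `a > 0`, the unperturbed chain observed at an independent exponential time of rate `a + r`,
`R = K ∘ₖ (const Exp_{a+r} ×ₖ id)` (the normalised resolvent kernel, as in the tree's
`LangevinChainResolvent.lean`), the alternations `W_n = R (Q R)^n` (`W_0 = R`, `W_{n+1} = R ∘ₖ Q ∘ₖ W_n`)
and the Neumann-series kernel `RQ(x) = ∑_n p_n W_n(x)` with the geometric weights
`p_n = (a/(a+r)) (r/(a+r))^n` (which IS the normalised resolvent at rate `a` of the perturbed semigroup,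
by the Laplace transform of the jump expansion — step IV). Results:

* `isMarkovKernel_R/W/RQ`, `hasSum_laplaceWeight` (`∑ p_n = 1`), `hasSum_integral_W`
  (`∫ h dRQ = ∑ p_n ∫ h dW_n` for bounded measurable `h`), `integral_W_succ`;
* `integral_R_eq_of_dynkin` — the unperturbed resolvent identity for an abstract bounded measurable
  Dynkin pair `(f, g)` (`∫ f dP_t - f = ∫₀ᵗ ∫ g dP_s`): `∫ g dR = (a+r)(∫ f dR - f)`;
* `integral_RQ_eq_of_dynkin` — **the resolvent identity of the perturbed chain**:
  `∫ (g + r(Qf - f)) dRQ(x) = a (∫ f dRQ(x) - f x)`, i.e. `RQ` inverts `a - (L + r(Q - 1))` on Dynkin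
  pairs: the jump-perturbed process has generator `L + r(Q - 1)` (for the flip chain, `r = Nε`,
  `Q = flipKernel N`: `L + εS`). Proof: telescoping of the Neumann series against the unperturbed
  identity at every intermediate state.

No definitions. Registered sub-goal: `helper_jumpResolventIdentity` (the last theorem on the phase space
of the chain). References: Ethier–Kurtz 1986, Ch. 1 §7 and Ch. 4 §10; folklore.
-/

noncomputable section

namespace Summit.AtomisticToContinuum.FouriersLaw.Theorems.VanishingNoiseBound.JumpPerturbation

open MeasureTheory ProbabilityTheory Filter Topology Set Function
open scoped NNReal ENNReal
open Literature.MathematicalPhysics.KineticTheory.HeatConduction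

variable {X : Type*} [MeasurableSpace X]

/-- Bounded measurable functions are integrable for finite measures. [folklore] -/
theorem integrable_of_norm_le {ν : Measure X} [IsFiniteMeasure ν] {h : X → ℝ} (hm : Measurable h)
    {C : ℝ} (hC : ∀ x, ‖h x‖ ≤ C) : Integrable h ν :=
  Integrable.of_bound hm.aestronglyMeasurable C (ae_of_all _ hC)

/-- A Markov kernel maps functions bounded by `C` to functions bounded by `C`. [folklore] -/
theorem norm_integral_markov_le (κ : Kernel X X) [IsMarkovKernel κ] {h : X → ℝ} {C : ℝ}
    (hC : ∀ x, ‖h x‖ ≤ C) (y : X) : ‖∫ z, h z ∂(κ y)‖ ≤ C :=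
  (norm_integral_le_of_norm_le_const (Eventually.of_forall hC)).trans (by simp)

/-- `y ↦ ∫ h dκ(y)` is measurable for measurable real `h`. [folklore] -/
theorem measurable_integral_kernel (κ : Kernel X X) {h : X → ℝ} (hm : Measurable h) :
    Measurable fun y => ∫ z, h z ∂(κ y) :=
  (hm.stronglyMeasurable.integral_kernel (κ := κ)).measurable

section Resolvent

variable (K : Kernel (ℝ × X) X) (Q : Kernel X X) {r : ℝ} (hr : 0 < r) {a : ℝ} (ha : 0 < a)
  (R : Kernel X X) (hR : R = K ∘ₖ (Kernel.const X (expMeasure (a + r)) ×ₖ Kernel.id))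
  (W : ℕ → Kernel X X) (hW0 : W 0 = R) (hWsucc : ∀ n, W (n + 1) = R ∘ₖ (Q ∘ₖ W n))
  (RQ : Kernel X X)
  (hRQ : ∀ x, RQ x = Measure.sum fun n => ENNReal.ofReal (a / (a + r) * (r / (a + r)) ^ n) • W n x)

include hr ha hR in
/-- The time-averaged kernel `R = R_{a+r}` (the unperturbed chain observed at an independent
exponential time of rate `a + r`) is Markov. [folklore] -/
theorem isMarkovKernel_R [IsMarkovKernel K] : IsMarkovKernel R := by
  haveI := isProbabilityMeasure_expMeasure (show 0 < a + r by linarith)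
  rw [hR]; infer_instance

include hr ha hR hW0 hWsucc in
/-- The alternations `W_n = R (Q R)^n` are Markov. [folklore] -/
theorem isMarkovKernel_W [IsMarkovKernel K] [IsMarkovKernel Q] (n : ℕ) : IsMarkovKernel (W n) := by
  haveI := isMarkovKernel_R K hr ha R hR
  induction n with
  | zero => rw [hW0]; infer_instance
  | succ n ih => rw [hWsucc n]; infer_instance

omit [MeasurableSpace X] in
include hr ha in
/-- The geometric weights `p_n = (a/(a+r))(r/(a+r))^n` sum to one. [folklore] -/
theorem hasSum_laplaceWeight : HasSum (fun n : ℕ => a / (a + r) * (r / (a + r)) ^ n) 1 := by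
  have hb : 0 < a + r := by linarith
  have hρ0 : 0 ≤ r / (a + r) := by positivity
  have hρ1 : r / (a + r) < 1 := by rw [div_lt_one hb]; linarith
  have h := (hasSum_geometric_of_lt_one hρ0 hρ1).mul_left (a / (a + r))
  have h1 : 1 - r / (a + r) = a / (a + r) := by
    field_simp
    ring
  rw [h1, mul_inv_cancel₀ (div_pos ha hb).ne'] at h
  exact h

include hr ha hR hW0 hWsucc hRQ in
/-- The Neumann-series kernel `RQ = ∑_n p_n W_n` is Markov. [folklore] -/
theorem isMarkovKernel_RQ [IsMarkovKernel K] [IsMarkovKernel Q] : IsMarkovKernel RQ := by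
  refine ⟨fun x => ⟨?_⟩⟩
  rw [hRQ x, Measure.sum_apply _ MeasurableSet.univ]
  have h : ∀ n, (ENNReal.ofReal (a / (a + r) * (r / (a + r)) ^ n) • W n x) univ =
      ENNReal.ofReal (a / (a + r) * (r / (a + r)) ^ n) := by
    intro n
    haveI := isMarkovKernel_W K Q hr ha R hR W hW0 hWsucc n
    rw [Measure.smul_apply, measure_univ, smul_eq_mul, mul_one]
  simp_rw [h]
  have hs := hasSum_laplaceWeight hr ha
  have hb : 0 < a + r := by linarith
  rw [← ENNReal.ofReal_tsum_of_nonneg (fun n => by positivity) hs.summable, hs.tsum_eq,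
    ENNReal.ofReal_one]

include hr ha hR hW0 hWsucc hRQ in
/-- **Integration against the Neumann-series kernel**: for bounded measurable `h`,
`∑_n p_n ∫ h dW_n(x) = ∫ h dRQ(x)` as a convergent series. [folklore] -/
theorem hasSum_integral_W [IsMarkovKernel K] [IsMarkovKernel Q] (x : X) {h : X → ℝ}
    (hm : Measurable h) {C : ℝ} (hC : ∀ x, ‖h x‖ ≤ C) :
    HasSum (fun n => a / (a + r) * (r / (a + r)) ^ n * ∫ z, h z ∂(W n x)) (∫ z, h z ∂(RQ x)) := by
  have hb : 0 < a + r := by linarith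
  haveI := isMarkovKernel_RQ K Q hr ha R hR W hW0 hWsucc RQ hRQ
  have hint : Integrable h (RQ x) := integrable_of_norm_le hm hC
  rw [hRQ x] at hint ⊢
  have hsum := hasSum_integral_measure hint
  have he : (fun n => ∫ z, h z ∂(ENNReal.ofReal (a / (a + r) * (r / (a + r)) ^ n) • W n x)) =
      fun n => a / (a + r) * (r / (a + r)) ^ n * ∫ z, h z ∂(W n x) := by
    funext n
    rw [integral_smul_measure, ENNReal.toReal_ofReal (by positivity), smul_eq_mul]
  rw [he] at hsum
  exact hsum

include hr ha hR hWsucc in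
/-- One more alternation: `∫ h dW_{n+1}(x) = ∫ W_n(x, dy) ∫ Q(y, dy') ∫ R(y', dz) h(z)` for bounded
measurable `h`. [folklore] -/
theorem integral_W_succ [IsMarkovKernel K] [IsMarkovKernel Q] (hW0' : W 0 = R) (n : ℕ) (x : X)
    {h : X → ℝ} (hm : Measurable h) {C : ℝ} (hC : ∀ x, ‖h x‖ ≤ C) :
    ∫ z, h z ∂(W (n + 1) x) = ∫ y, ∫ y', ∫ z, h z ∂(R y') ∂(Q y) ∂(W n x) := by
  haveI := isMarkovKernel_R K hr ha R hR
  haveI := isMarkovKernel_W K Q hr ha R hR W hW0' hWsucc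
  rw [hWsucc n, Kernel.integral_comp (integrable_of_norm_le hm hC),
    Kernel.integral_comp]
  exact integrable_of_norm_le (measurable_integral_kernel R hm) (norm_integral_markov_le R hC)

include hr ha hR in
/-- **The resolvent identity of the unperturbed chain** (abstract Dynkin pair): if
`∫ f dP_t(x,·) - f x = ∫₀ᵗ ∫ g dP_s(x,·) ds` for all `t ≥ 0` (`f, g` bounded measurable), then
`∫ g dR(x) = (a + r)(∫ f dR(x) - f x)` for the chain observed at an exponential time of rate
`a + r`. (Dynkin integrated against the exponential law; verbatim the tree's
`LangevinChainSemigroup.integral_generator_comp_const_prod_id` for an abstract pair.) [folklore] -/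
theorem integral_R_eq_of_dynkin [IsMarkovKernel K] (x : X) {f g : X → ℝ} (hfm : Measurable f)
    (hgm : Measurable g) {Cf Cg : ℝ} (hCf : ∀ x, ‖f x‖ ≤ Cf) (hCg : ∀ x, ‖g x‖ ≤ Cg)
    (hdyn : ∀ t : ℝ, 0 ≤ t → ∫ y, f y ∂(K (t, x)) - f x = ∫ s in (0:ℝ)..t, ∫ y, g y ∂(K (s, x))) :
    ∫ y, g y ∂(R x) = (a + r) * (∫ y, f y ∂(R x) - f x) := by
  -- adapted from `LangevinChainSemigroup.integral_generator_comp_const_prod_id`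
  -- (Literature/MathematicalPhysics/KineticTheory/LangevinChainResolvent.lean)
  have hb : 0 < a + r := by linarith
  haveI := isProbabilityMeasure_expMeasure hb
  set ρ := expMeasure (a + r) with hρ
  set ψ : ℝ → ℝ := fun t => ∫ y, g y ∂(K (t, x)) with hψ
  have hKm : ∀ {h : X → ℝ}, Measurable h → StronglyMeasurable fun t : ℝ => ∫ y, h y ∂(K (t, x)) :=
    fun {h} hh => (hh.stronglyMeasurable.integral_kernel (κ := K)).comp_measurable
      (measurable_id.prodMk measurable_const)
  have hKb : ∀ {h : X → ℝ} {C : ℝ}, (∀ y, ‖h y‖ ≤ C) → ∀ t, ‖∫ y, h y ∂(K (t, x))‖ ≤ C :=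
    fun {h C} hh t => (norm_integral_le_of_norm_le_const (Eventually.of_forall hh)).trans (by simp)
  have hL : ∫ y, g y ∂(R x) = (a + r) * ∫ t in Ioi 0, Real.exp (-((a + r) * t)) * ψ t := by
    rw [hR, integral_comp_const_prod_id K ρ x hgm.stronglyMeasurable hCg,
      integral_expMeasure_eq_integral_Ioi hb, ← integral_const_mul]
    refine setIntegral_congr_fun measurableSet_Ioi fun t _ => ?_
    simp only [hψ]; ring
  have hRf : ∫ y, f y ∂(R x) - f x =
      ∫ t in Ioi 0, (a + r) * Real.exp (-((a + r) * t)) * ∫ s in (0:ℝ)..t, ψ s := by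
    rw [hR, integral_comp_const_prod_id K ρ x hfm.stronglyMeasurable hCf]
    have hφi : Integrable (fun t => ∫ y, f y ∂(K (t, x))) ρ :=
      (integrable_const Cf).mono' (hKm hfm).aestronglyMeasurable (Eventually.of_forall (hKb hCf))
    have e1 : ∫ t, ∫ y, f y ∂(K (t, x)) ∂ρ - f x = ∫ t, (∫ y, f y ∂(K (t, x)) - f x) ∂ρ := by
      rw [integral_sub hφi (integrable_const _), integral_const, probReal_univ, one_smul]
    rw [e1, integral_expMeasure_eq_integral_Ioi hb]
    refine setIntegral_congr_fun measurableSet_Ioi fun t ht => ?_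
    rw [hdyn t (le_of_lt ht)]
  rw [hL, hRf, integral_exp_mul_intervalIntegral_eq (hKm hgm).measurable (hKb hCg) hb]


include hr ha hR hW0 hWsucc hRQ in
/-- **The resolvent identity of the perturbed chain, Neumann-series form.** Let `(f, g)` be a
bounded measurable Dynkin pair of the unperturbed semigroup at EVERY state
(`∫ f dP_t(y,·) - f y = ∫₀ᵗ ∫ g dP_s(y,·) ds`, `t ≥ 0`). Then for `a > 0`, with `p_n = (a/(a+r))(r/(a+r))^n`
and `RQ = ∑_n p_n W_n` (`W_n = R_{a+r}(Q R_{a+r})^n`):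
`∫ (g + r (Qf - f)) dRQ(x) = a (∫ f dRQ(x) - f x)` — the resolvent identity of a Markov process with
generator `L + r(Q - 1)` (`L` the generator of the pair), obtained by telescoping the series with the
unperturbed resolvent identity `∫ g dR = (a+r)(∫ f dR - f)` at every intermediate state.
[Ethier–Kurtz 1986, Ch. 1 §7 (perturbation of resolvents) and Ch. 4 §10; folklore] -/
theorem integral_RQ_eq_of_dynkin [IsMarkovKernel K] [IsMarkovKernel Q] (x : X) {f g : X → ℝ}
    (hfm : Measurable f) (hgm : Measurable g) {Cf Cg : ℝ} (hCf : ∀ y, ‖f y‖ ≤ Cf) (hCg : ∀ y, ‖g y‖ ≤ Cg)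
    (hdyn : ∀ t : ℝ, 0 ≤ t → ∀ y : X,
      ∫ z, f z ∂(K (t, y)) - f y = ∫ s in (0:ℝ)..t, ∫ z, g z ∂(K (s, y))) :
    ∫ y, (g y + r * ((∫ z, f z ∂(Q y)) - f y)) ∂(RQ x) = a * ((∫ y, f y ∂(RQ x)) - f x) := by
  have hb : 0 < a + r := by linarith
  haveI := isMarkovKernel_R K hr ha R hR
  haveI := isMarkovKernel_W K Q hr ha R hR W hW0 hWsucc
  haveI := isMarkovKernel_RQ K Q hr ha R hR W hW0 hWsucc RQ hRQ
  -- the auxiliary observables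
  set Qf : X → ℝ := fun y => ∫ z, f z ∂(Q y) with hQf
  have hQfm : Measurable Qf := measurable_integral_kernel Q hfm
  have hQfb : ∀ y, ‖Qf y‖ ≤ Cf := norm_integral_markov_le Q hCf
  set Rf : X → ℝ := fun y => ∫ z, f z ∂(R y) with hRf
  have hRfm : Measurable Rf := measurable_integral_kernel R hfm
  have hRfb : ∀ y, ‖Rf y‖ ≤ Cf := norm_integral_markov_le R hCf
  set d : X → ℝ := fun y => g y - r * f y with hd
  have hdm : Measurable d := hgm.sub (hfm.const_mul r)
  have hdb : ∀ y, ‖d y‖ ≤ Cg + |r| * Cf := fun y => by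
    calc ‖g y - r * f y‖ ≤ ‖g y‖ + ‖r * f y‖ := norm_sub_le _ _
      _ ≤ Cg + |r| * Cf := by
          rw [norm_mul, Real.norm_eq_abs]
          exact add_le_add (hCg y) (mul_le_mul_of_nonneg_left (hCf y) (abs_nonneg r))
  -- integrability boilerplate
  have hint : ∀ (ν : Measure X) [IsFiniteMeasure ν] {h : X → ℝ}, Measurable h → ∀ {C : ℝ},
      (∀ y, ‖h y‖ ≤ C) → Integrable h ν := fun ν _ h hm C hC => integrable_of_norm_le hm hC
  -- the unperturbed resolvent identity at every state: `∫ (g - r f) dR(y) = a Rf(y) - (a+r) f(y)`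
  have key : ∀ y, ∫ z, d z ∂(R y) = a * Rf y - (a + r) * f y := by
    intro y
    have h1 := integral_R_eq_of_dynkin K hr ha R hR y hfm hgm hCf hCg (fun t ht => hdyn t ht y)
    simp only [hd]
    rw [integral_sub (hint _ hgm hCg) ((hint _ hfm hCf).const_mul r), integral_const_mul, h1]
    ring
  -- (e0) the zeroth alternation
  have e0 : ∫ y, d y ∂(W 0 x) = a * ∫ y, f y ∂(W 0 x) - (a + r) * f x := by
    rw [hW0]; exact key x
  -- (e1) one more alternation
  have e1 : ∀ n, ∫ y, d y ∂(W (n + 1) x) =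
      a * ∫ y, f y ∂(W (n + 1) x) - (a + r) * ∫ y, Qf y ∂(W n x) := by
    intro n
    rw [integral_W_succ K Q hr ha R hR W hWsucc hW0 n x hdm hdb,
      integral_W_succ K Q hr ha R hR W hWsucc hW0 n x hfm hCf]
    have h2 : ∀ y, ∫ y', ∫ z, d z ∂(R y') ∂(Q y) = a * ∫ y', Rf y' ∂(Q y) - (a + r) * Qf y := by
      intro y
      simp_rw [key]
      rw [integral_sub ((hint _ hRfm hRfb).const_mul a) ((hint _ hfm hCf).const_mul (a + r)),
        integral_const_mul, integral_const_mul]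
    simp_rw [h2]
    have hQRm : Measurable fun y => ∫ y', Rf y' ∂(Q y) := measurable_integral_kernel Q hRfm
    have hQRb : ∀ y, ‖∫ y', Rf y' ∂(Q y)‖ ≤ Cf := norm_integral_markov_le Q hRfb
    rw [integral_sub ((hint _ hQRm hQRb).const_mul a) ((hint _ hQfm hQfb).const_mul (a + r)),
      integral_const_mul, integral_const_mul]
  -- the three series
  have hSf := hasSum_integral_W K Q hr ha R hR W hW0 hWsucc RQ hRQ x hfm hCf
  have hSq := hasSum_integral_W K Q hr ha R hR W hW0 hWsucc RQ hRQ x hQfm hQfb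
  have hSd := hasSum_integral_W K Q hr ha R hR W hW0 hWsucc RQ hRQ x hdm hdb
  -- the weights `p_n = (a/(a+r)) (r/(a+r))^n`: `(a+r) p_0 = a`, `(a+r) p_{n+1} = r p_n`
  have hp0 : (a + r) * (a / (a + r) * (r / (a + r)) ^ 0) = a := by
    rw [pow_zero, mul_one]; field_simp
  have hpsucc : ∀ n : ℕ, (a + r) * (a / (a + r) * (r / (a + r)) ^ (n + 1)) =
      r * (a / (a + r) * (r / (a + r)) ^ n) := fun n => by
    rw [pow_succ]; field_simp
  -- telescoping
  have hSf' : HasSum (fun n => a / (a + r) * (r / (a + r)) ^ (n + 1) * ∫ y, f y ∂(W (n + 1) x))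
      ((∫ y, f y ∂(RQ x)) - a / (a + r) * (r / (a + r)) ^ 0 * ∫ y, f y ∂(W 0 x)) := by
    have := (hasSum_nat_add_iff' 1).2 hSf
    simpa [Finset.sum_range_one] using this
  have h := (hSf'.mul_left a).sub (hSq.mul_left r)
  have hfun : (fun n => a * (a / (a + r) * (r / (a + r)) ^ (n + 1) * ∫ y, f y ∂(W (n + 1) x)) -
      r * (a / (a + r) * (r / (a + r)) ^ n * ∫ y, Qf y ∂(W n x))) =
      fun n => a / (a + r) * (r / (a + r)) ^ (n + 1) * ∫ y, d y ∂(W (n + 1) x) := by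
    funext n
    rw [e1 n]
    linear_combination (∫ y, Qf y ∂(W n x)) * hpsucc n
  rw [hfun] at h
  have hc : HasSum (fun n => a / (a + r) * (r / (a + r)) ^ n * ∫ y, d y ∂(W n x))
      (a / (a + r) * (r / (a + r)) ^ 0 * ∫ y, d y ∂(W 0 x) +
        (a * ((∫ y, f y ∂(RQ x)) - a / (a + r) * (r / (a + r)) ^ 0 * ∫ y, f y ∂(W 0 x)) -
          r * ∫ y, Qf y ∂(RQ x))) := h.zero_add
  have heq := hSd.unique hc
  -- assemble
  have hsplit : ∀ y, g y + r * ((∫ z, f z ∂(Q y)) - f y) = d y + r * Qf y := fun y => by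
    simp only [hd, hQf]; ring
  simp_rw [hsplit]
  rw [integral_add (hint _ hdm hdb) ((hint _ hQfm hQfb).const_mul r), integral_const_mul, heq, e0]
  linear_combination (-(f x)) * hp0

end Resolvent

/-- **Registered sub-goal `helper_jumpResolventIdentity`** of stmt-AtomisticToContinuum-11976 (brick for stub
S3 `stub_noisyPositiveConductance`): `integral_RQ_eq_of_dynkin` on the phase space of the `N`-particle
chain, fully quantified and notation-free. [folklore] -/
theorem helper_jumpResolventIdentity : ∀ (N : ℕ) (K : ProbabilityTheory.Kernel (ℝ × Literature.MathematicalPhysics.KineticTheory.HeatConduction.PhaseSpace N) (Literature.MathematicalPhysics.KineticTheory.HeatConduction.PhaseSpace N)) [ProbabilityTheory.IsMarkovKernel K] (Q : ProbabilityTheory.Kernel (Literature.MathematicalPhysics.KineticTheory.HeatConduction.PhaseSpace N) (Literature.MathematicalPhysics.KineticTheory.HeatConduction.PhaseSpace N)) [ProbabilityTheory.IsMarkovKernel Q] (r : ℝ), 0 < r → ∀ (a : ℝ), 0 < a → ∀ (R : ProbabilityTheory.Kernel (Literature.MathematicalPhysics.KineticTheory.HeatConduction.PhaseSpace N) (Literature.MathematicalPhysics.KineticTheory.HeatConduction.PhaseSpace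 N)), R = ProbabilityTheory.Kernel.comp K (ProbabilityTheory.Kernel.prod (ProbabilityTheory.Kernel.const (Literature.MathematicalPhysics.KineticTheory.HeatConduction.PhaseSpace N) (ProbabilityTheory.expMeasure (a + r))) ProbabilityTheory.Kernel.id) → ∀ (W : ℕ → ProbabilityTheory.Kernel (Literature.MathematicalPhysics.KineticTheory.HeatConduction.PhaseSpace N) (Literature.MathematicalPhysics.KineticTheory.HeatConduction.PhaseSpace N)), W 0 = R → (∀ n, W (n + 1) = ProbabilityTheory.Kernel.comp R (ProbabilityTheory.Kernel.comp Q (W n))) → ∀ (RQ : ProbabilityTheory.Kernel (Literature.MathematicalPhysics.KineticTheory.HeatConduction.PhaseSpace N) (Literature.MathematicalPhysics.KineticTheory.HeatConduction.PhaseSpace N)), (∀ x, RQ x = MeasureTheory.Measure.sum fun n => ENNReal.ofReal (a / (a + r) * (r / (a + r)) ^ n) • W n x) → ∀ (x : Literature.MathematicalPhysics.KineticTheory.HeatConduction.PhaseSpace N) (f g : Literature.MathematicalPhysics.KineticTheory.HeatConduction.PhaseSpace N → ℝ), Measurable f → Measurable g → ∀ (Cf Cg : ℝ), (∀ y, ‖f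 y‖ ≤ Cf) → (∀ y, ‖g y‖ ≤ Cg) → (∀ t : ℝ, 0 ≤ t → ∀ y : Literature.MathematicalPhysics.KineticTheory.HeatConduction.PhaseSpace N, MeasureTheory.integral (K (t, y)) (fun z => f z) - f y = intervalIntegral (fun s => MeasureTheory.integral (K (s, y)) (fun z => g z)) 0 t MeasureTheory.volume) → MeasureTheory.integral (RQ x) (fun y => g y + r * (MeasureTheory.integral (Q y) (fun z => f z) - f y)) = a * (MeasureTheory.integral (RQ x) (fun y => f y) - f x) :=
  fun _ K _ Q _ _ hr _ ha R hR W hW0 hWsucc RQ hRQ x _ _ hfm hgm _ _ hCf hCg hdyn =>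
    integral_RQ_eq_of_dynkin K Q hr ha R hR W hW0 hWsucc RQ hRQ x hfm hgm hCf hCg hdyn

end Summit.AtomisticToContinuum.FouriersLaw.Theorems.VanishingNoiseBound.JumpPerturbation

end
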